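import Literature.NumberTheory.GelbartRogawski1991.UnitaryDualPairThetaKernelCM
import Literature.NumberTheory.ComplexMultiplication.CMTypeCount
import HarnessLib

-- buildfix G11b-3 recipe (LEDGER B13-1/B13-3): elaborate sequentially so the trailing `attribute [implicit_reducible]`
-- block (reducibilityCoreExt is keyed to the async environment branch) is in force at `.olean` export.
set_option Elab.async false

/-!
# Gelbart–Rogawski 1991, §3.1 — the splitting datum at `n = 3`: the dual pairs `(U(2,1), U(1))` and
# `(U(3), U(1))` over a CM field (validation instance V-C2.ii of the Layer-C definitions tribunal; kernel only)

Topic `NumberTheory/GelbartRogawski1991`; namespace `Literature.NumberTheory.GelbartRogawski1991.UnitaryDualPair`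
(continues `UnitaryDualPairSplittingDatum` / `UnitaryDualPairThetaKernelCM`).  KERNEL ONLY: definitions and proved
lemmas, **no named fact, no `Prop`-valued definition, no proof holes**; nothing about [GelbartRogawski1991,
Prop. 3.1.1] (`SplittingDatum.CompatibleSplitting`) is asserted — where it appears below it is an explicit
hypothesis `hGR`, exactly as in the files this one instantiates.

WHAT THIS FILE IS.  The abstract splitting datum of [GelbartRogawski1991, §3.1 p. 454 L21–48]
(`UnitaryDualPair.splittingDatum`, all fields CONSTRUCTED in `UnitaryDualPairSplittingDatum`) and its CM
specialisation `cmSplittingDatum L e dV … dW …` (`UnitaryDualPairThetaKernelCM`: `F := L⁺`, `E := L`,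
`c := complexConj`, `T_V := diag(dV)`, `T_W := diag(dW)`) are typed for arbitrary ranks `N`, `M` and an
enumeration `e : Fin N × Fin M ≃ Fin n`.  The Layer-C definitions tribunal (lane `lit-hodgefound`,
TRIBUNAL-C §2 C2 (ii) / §1b V-C2.ii, DAG-C C2-01 → P-C2-01) demands the INSTANCE at which the E-term's theta
kernel lives: "*`(U(3), U(1))` with `T_V = diag(1,1,-1)`, `T_W = (1)`: the splitting datum elaborates with
`n = 3` and `isUnit_det_gram` holds*".  This file supplies it, for every CM field `L` and for the Gaussian
field `ℚ(i) = ℚ(ζ₄)` of `ComplexMultiplication.CMTypeCount`: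

* `signVec21 L = (1, 1, −1)`, `signVec30 L = (1, 1, 1)` (`Fin 3 → L`) and `unitVec L = (1)` (`Fin 1 → L`; it is
  `lineVec L 1` of `UnitaryDualPairSeesawCMLines` on the nose), conjugation-fixed and non-zero
  (`complexConj_signVec21`, `signVec21_ne_zero`, …) — the hypotheses `hdV`, `hdV0`, `hdW`, `hdW0` of
  `cmSplittingDatum` DISCHARGED;
* the enumeration `enum31 : Fin 3 × Fin 1 ≃ Fin 3` (`Equiv.prodUnique`), so `n = N·M = 3`;
* **`cmSplittingDatumU21U1 L`** and **`cmSplittingDatumU3U1 L`** : `SplittingDatum Sp(𝕎_𝔸) Mp_ψ(𝕎_𝔸)ᶜᵒⁿᵗ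
  (U(diag(1,1,∓1))(𝔸_{L⁺}) ×' U(1)(𝔸_{L⁺}))` with `𝕎_𝔸 = 𝔸_{L⁺}³ × 𝔸_{L⁺}³` — `cmSplittingDatum` AT these data
  (definitional, `cmSplittingDatumU21U1_eq`); the Gram matrix `𝕋_{L⁺} = reindex (diag(1,1,∓1) ⊗ₖ (1))` has unit
  determinant (`isUnit_det_gram_signVec21`, `isUnit_det_gram_signVec30` — the tribunal's check) and indeed
  `det 𝕋 = −1`, resp. `1` (`algebraMap_det_gram_signVec21`, `algebraMap_det_gram_signVec30`);
* the pair splitting at the instance from an explicit `hGR` (`exists_pairSplitting_U21U1`) — the binders of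
  `Weil1964.ThetaKernelDatum.adelicOfDualPair` for `U(2,1) × U(1)`, Prop. 3.1.1 entering as the HYPOTHESIS it is
  in the tree;
* the Gaussian instances `gaussianSplittingDatumU21U1`, `gaussianSplittingDatumU3U1` over
  `CMTypeCount.GaussianField = CyclotomicField 4 ℚ` (no variables at all).

References: S. Gelbart, J. Rogawski, *L-functions and Fourier–Jacobi coefficients for the unitary group
`U(3)`*, Invent. Math. 105 (1991) 445–472, §3.1 pp. 454–455 [GelbartRogawski1991]; A. Weil, Acta Math. 111
(1964), Chap. III n° 41 [Weil1964].
-/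

noncomputable section

open scoped Matrix Kronecker
open NumberField
open Literature.RepresentationTheory.HeisenbergGroup
open Literature.NumberTheory.Automorphic
open Literature.NumberTheory.Weil1964

namespace Literature.NumberTheory.GelbartRogawski1991

namespace UnitaryDualPair

/-! ## §1. The diagonal data `(1, 1, ∓1)`, `(1)` and the enumeration `Fin 3 × Fin 1 ≃ Fin 3` -/

section Data

variable (L : Type) [Field L]

/-- the diagonal `(1, 1, −1)` of the hermitian form of signature `(2,1)` on `L³` (`T_V = diag(1,1,−1)`).
[cite: GelbartRogawski1991, §3.1 p. 454] -/
def signVec21 : Fin 3 → L := ![1, 1, -1]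

/-- the diagonal `(1, 1, 1)` of the definite hermitian form on `L³` (`T_V = 1₃`). [cite: GelbartRogawski1991, §3.1 p. 454] -/
def signVec30 : Fin 3 → L := ![1, 1, 1]

/-- the diagonal `(1)` of the hermitian line `W = L`, `⟨x, y⟩ = x̄ y` (`T_W = (1)`); it is `lineVec L 1` of
`UnitaryDualPairSeesawCMLines` definitionally. [cite: GelbartRogawski1991, §3.1 p. 454] -/
def unitVec : Fin 1 → L := fun _ => 1

/-- entry `0` of `(1, 1, −1)` (plumbing). [folklore] -/
@[simp] private theorem signVec21_zero : signVec21 L 0 = 1 := rfl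

/-- entry `1` of `(1, 1, −1)` (plumbing). [folklore] -/
@[simp] private theorem signVec21_one : signVec21 L 1 = 1 := rfl

/-- entry `2` of `(1, 1, −1)` (plumbing). [folklore] -/
@[simp] private theorem signVec21_two : signVec21 L 2 = -1 := rfl

/-- entries of `(1, 1, 1)` (plumbing). [folklore] -/
@[simp] private theorem signVec30_apply (i : Fin 3) : signVec30 L i = 1 := by
  fin_cases i <;> rfl

/-- entries of `(1)` (plumbing). [folklore] -/
@[simp] private theorem unitVec_apply (i : Fin 1) : unitVec L i = 1 := rfl

/-- `(1, 1, −1)` has non-zero entries: `T_V = diag(1,1,−1) ∈ GL₃(F)` is an admissible Gram matrix of the §3.1 datum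
(hypothesis `hdV0` of `cmSplittingDatum`). [cite: GelbartRogawski1991, §3.1 p. 454 L43–48] -/
theorem signVec21_ne_zero (i : Fin 3) : signVec21 L i ≠ 0 := by
  fin_cases i
  · exact one_ne_zero
  · exact one_ne_zero
  · exact neg_ne_zero.2 one_ne_zero

/-- `(1, 1, 1)` has non-zero entries: `T_V = 1₃ ∈ GL₃(F)` (hypothesis `hdV0`). [cite: GelbartRogawski1991, §3.1 p. 454 L43–48] -/
theorem signVec30_ne_zero (i : Fin 3) : signVec30 L i ≠ 0 := by
  rw [signVec30_apply]; exact one_ne_zero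

/-- `(1)` is non-zero: `T_W = (1) ∈ GL₁(F)` (hypothesis `hdW0`). [cite: GelbartRogawski1991, §3.1 p. 454 L43–48] -/
theorem unitVec_ne_zero (i : Fin 1) : unitVec L i ≠ 0 := one_ne_zero

/-- the enumeration `e : Fin 3 × Fin 1 ≃ Fin 3`, `(i, 0) ↦ i`, of `Res(V ⊗ W)`, `dim V = 3`, `dim W = 1`:
`n = N·M = 3`. [folklore] -/
def enum31 : Fin 3 × Fin 1 ≃ Fin 3 := Equiv.prodUnique (Fin 3) (Fin 1)

/-- `e (i, 0) = i` (plumbing). [folklore] -/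
@[simp] private theorem enum31_apply (p : Fin 3 × Fin 1) : enum31 p = p.1 := rfl

/-- `e⁻¹ i = (i, 0)` (plumbing). [folklore] -/
@[simp] private theorem enum31_symm_apply (i : Fin 3) : enum31.symm i = (i, 0) := rfl

end Data

section Conj

variable (L : Type) [Field L] [NumberField L] [IsCMField L]

/-- `(1, 1, −1)` is fixed by complex conjugation: `T_V = diag(1,1,−1)` is `F`-rational, `F = L⁺` (hypothesis `hdV` of
`cmSplittingDatum`). [cite: GelbartRogawski1991, §3.1 p. 454 L43–48] -/
theorem complexConj_signVec21 (i : Fin 3) : IsCMField.complexConj L (signVec21 L i) = signVec21 L i := by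
  fin_cases i <;> simp

/-- `(1, 1, 1)` is fixed by complex conjugation: `T_V = 1₃` is `F`-rational (hypothesis `hdV`).
[cite: GelbartRogawski1991, §3.1 p. 454 L43–48] -/
theorem complexConj_signVec30 (i : Fin 3) : IsCMField.complexConj L (signVec30 L i) = signVec30 L i := by
  simp

/-- `(1)` is fixed by complex conjugation: `T_W = (1)` is `F`-rational (hypothesis `hdW`).
[cite: GelbartRogawski1991, §3.1 p. 454 L43–48] -/
theorem complexConj_unitVec (i : Fin 1) : IsCMField.complexConj L (unitVec L i) = unitVec L i := by
  simp

end Conj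

/-! ## §2. The Gram matrix `𝕋 = reindex (diag(1,1,∓1) ⊗ₖ (1))` has unit determinant (the tribunal's check) -/

section Gram

variable (L : Type) [Field L] [NumberField L] [IsCMField L]

/-- **`det 𝕋_{L⁺}` is a unit** for `T_V = diag(1,1,−1)`, `T_W = (1)` — the hypothesis under which the rational
symplectic group `Sp_F(𝕎)` and Weil's section `r_F` of the datum are built (`isUnit_det_gram`).
[cite: GelbartRogawski1991, §3.1 p. 454 L43–48] -/
theorem isUnit_det_gram_signVec21 :
    IsUnit (gram (↥(maximalRealSubfield L)) enum31 (realDiagonal L (signVec21 L) (complexConj_signVec21 L))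
      (realDiagonal L (unitVec L) (complexConj_unitVec L))).det :=
  isUnit_det_gram _ _ (isUnit_det_realDiagonal L _ _ (signVec21_ne_zero L))
    (isUnit_det_realDiagonal L _ _ (unitVec_ne_zero L))

/-- **`det 𝕋_{L⁺}` is a unit** for `T_V = 1₃`, `T_W = (1)`. [cite: GelbartRogawski1991, §3.1 p. 454 L43–48] -/
theorem isUnit_det_gram_signVec30 :
    IsUnit (gram (↥(maximalRealSubfield L)) enum31 (realDiagonal L (signVec30 L) (complexConj_signVec30 L))
      (realDiagonal L (unitVec L) (complexConj_unitVec L))).det :=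
  isUnit_det_gram _ _ (isUnit_det_realDiagonal L _ _ (signVec30_ne_zero L))
    (isUnit_det_realDiagonal L _ _ (unitVec_ne_zero L))

/-- the determinant of the Gram matrix of `Res(V ⊗ W)` in terms of those of `V` and `W`:
`det (reindex e e (T_V ⊗ₖ T_W)) = (det T_V)^M (det T_W)^N` (helper). [folklore] -/
private theorem det_gram (F : Type) [Field F] {N M n : ℕ} (e : Fin N × Fin M ≃ Fin n) (TV : Matrix (Fin N) (Fin N) F)
    (TW : Matrix (Fin M) (Fin M) F) : (gram F e TV TW).det = TV.det ^ M * TW.det ^ N := by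
  rw [gram, Matrix.det_reindex_self, Matrix.det_kronecker, Fintype.card_fin, Fintype.card_fin]

/-- `det diag(d)`, read in `L`, is `∏ dᵢ` (helper). [folklore] -/
private theorem algebraMap_det_realDiagonal {N : ℕ} (d : Fin N → L) (hd : ∀ i, IsCMField.complexConj L (d i) = d i) :
    algebraMap (↥(maximalRealSubfield L)) L (realDiagonal L d hd).det = ∏ i, d i := by
  rw [RingHom.map_det, RingHom.mapMatrix_apply, realDiagonal_map, Matrix.det_diagonal]

/-- **`det 𝕋 = −1`** for `T_V = diag(1,1,−1)`, `T_W = (1)` (read in `L`): the Gram matrix of `W = Res_{E/F} V ⊗ V′`,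
`φ = Tr_{E/F}(Φ)`, is non-degenerate. [cite: GelbartRogawski1991, §3.1 p. 454 L43–48] -/
theorem algebraMap_det_gram_signVec21 :
    algebraMap (↥(maximalRealSubfield L)) L
        (gram (↥(maximalRealSubfield L)) enum31 (realDiagonal L (signVec21 L) (complexConj_signVec21 L))
          (realDiagonal L (unitVec L) (complexConj_unitVec L))).det = -1 := by
  rw [det_gram, map_mul, map_pow, map_pow, algebraMap_det_realDiagonal, algebraMap_det_realDiagonal]
  simp [Fin.prod_univ_three]

/-- **`det 𝕋 = 1`** for `T_V = 1₃`, `T_W = (1)` (read in `L`). [cite: GelbartRogawski1991, §3.1 p. 454 L43–48] -/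
theorem algebraMap_det_gram_signVec30 :
    algebraMap (↥(maximalRealSubfield L)) L
        (gram (↥(maximalRealSubfield L)) enum31 (realDiagonal L (signVec30 L) (complexConj_signVec30 L))
          (realDiagonal L (unitVec L) (complexConj_unitVec L))).det = 1 := by
  rw [det_gram, map_mul, map_pow, map_pow, algebraMap_det_realDiagonal, algebraMap_det_realDiagonal]
  simp

end Gram

/-! ## §3. The splitting data of `(U(2,1), U(1))` and `(U(3), U(1))` over `L / L⁺` -/

section Datum

variable (L : Type) [Field L] [NumberField L] [IsCMField L]

/-- **The splitting datum of [GelbartRogawski1991, §3.1] for the dual pair `(U(2,1), U(1))` over the CM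
extension `L / L⁺`** — `U(2,1) = U(diag(1,1,−1))`, `U(1) = U((1))`, `𝕎 = Res_{L/L⁺}(V ⊗_L W)` of `L⁺`-dimension
`2n`, `n = 3`: `cmSplittingDatum` at `dV = (1,1,−1)`, `dW = (1)`, `e = enum31`, with its four side conditions
discharged.  All fields (`Sp(𝕎_𝔸)`, `Mp_ψ(𝕎_𝔸)ᶜᵒⁿᵗ`, `π`, `ι`, `G₁(L⁺)`, `Sp_{L⁺}(𝕎)`, Weil's `r_F`) are the
constructed ones of `UnitaryDualPairSplittingDatum`. [cite: GelbartRogawski1991, §3.1 p. 454 L21–48] -/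
def cmSplittingDatumU21U1 :
    SplittingDatum
      (symplecticGroup (polar (adelicForm (↥(maximalRealSubfield L)) (Fin 3)
        (adelicGram (↥(maximalRealSubfield L)) enum31
          (realDiagonal L (signVec21 L) (complexConj_signVec21 L))
          (realDiagonal L (unitVec L) (complexConj_unitVec L))))))
      (adelicMpCont (↥(maximalRealSubfield L)) (Fin 3)
        (adelicGram (↥(maximalRealSubfield L)) enum31
          (realDiagonal L (signVec21 L) (complexConj_signVec21 L))
          (realDiagonal L (unitVec L) (complexConj_unitVec L))))
      (UnitaryGroup.adelicPair (↥(maximalRealSubfield L)) L (IsCMField.complexConj L) 3 1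
        (Matrix.diagonal (signVec21 L)) (Matrix.diagonal (unitVec L))) :=
  cmSplittingDatum L enum31 (signVec21 L) (complexConj_signVec21 L) (signVec21_ne_zero L)
    (unitVec L) (complexConj_unitVec L) (unitVec_ne_zero L)

/-- **The splitting datum for the dual pair `(U(3), U(1))` over `L / L⁺`** (`T_V = 1₃`, `T_W = (1)`, `n = 3`).
[cite: GelbartRogawski1991, §3.1 p. 454 L21–48] -/
def cmSplittingDatumU3U1 :
    SplittingDatum
      (symplecticGroup (polar (adelicForm (↥(maximalRealSubfield L)) (Fin 3)
        (adelicGram (↥(maximalRealSubfield L)) enum31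
          (realDiagonal L (signVec30 L) (complexConj_signVec30 L))
          (realDiagonal L (unitVec L) (complexConj_unitVec L))))))
      (adelicMpCont (↥(maximalRealSubfield L)) (Fin 3)
        (adelicGram (↥(maximalRealSubfield L)) enum31
          (realDiagonal L (signVec30 L) (complexConj_signVec30 L))
          (realDiagonal L (unitVec L) (complexConj_unitVec L))))
      (UnitaryGroup.adelicPair (↥(maximalRealSubfield L)) L (IsCMField.complexConj L) 3 1
        (Matrix.diagonal (signVec30 L)) (Matrix.diagonal (unitVec L))) :=
  cmSplittingDatum L enum31 (signVec30 L) (complexConj_signVec30 L) (signVec30_ne_zero L)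
    (unitVec L) (complexConj_unitVec L) (unitVec_ne_zero L)

/-- `cmSplittingDatumU21U1 L` IS `cmSplittingDatum` at the `(2,1) × (1)` data (definitional).
[cite: GelbartRogawski1991, §3.1 p. 454 L21–48] -/
theorem cmSplittingDatumU21U1_eq :
    cmSplittingDatumU21U1 L =
      cmSplittingDatum L enum31 (signVec21 L) (complexConj_signVec21 L) (signVec21_ne_zero L)
        (unitVec L) (complexConj_unitVec L) (unitVec_ne_zero L) := rfl

/-- … and hence the generic `splittingDatum` at `F := L⁺`, `E := L`, `c := complexConj`, `N = 3`, `M = 1`,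
`J_V = diag(1,1,−1)`, `J_W = (1)` (definitional). [cite: GelbartRogawski1991, §3.1 p. 454 L21–48] -/
theorem cmSplittingDatumU21U1_eq_splittingDatum :
    cmSplittingDatumU21U1 L =
      splittingDatum (↥(maximalRealSubfield L)) L (IsCMField.complexConj L) 3 1 enum31
        (Matrix.diagonal (signVec21 L)) (Matrix.diagonal (unitVec L))
        (complexConj_imagUnit L) (imagUnit_ne_zero L) (imagUnit_mul_self L)
        (realDiagonal_isSymm L _ (complexConj_signVec21 L)) (realDiagonal_isSymm L _ (complexConj_unitVec L))
        (isUnit_det_realDiagonal L _ _ (signVec21_ne_zero L)) (isUnit_det_realDiagonal L _ _ (unitVec_ne_zero L))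
        (realDiagonal_map L _ (complexConj_signVec21 L)).symm (realDiagonal_map L _ (complexConj_unitVec L)).symm :=
  rfl

/-- `cmSplittingDatumU3U1 L` IS `cmSplittingDatum` at the `(3,0) × (1)` data (definitional).
[cite: GelbartRogawski1991, §3.1 p. 454 L21–48] -/
theorem cmSplittingDatumU3U1_eq :
    cmSplittingDatumU3U1 L =
      cmSplittingDatum L enum31 (signVec30 L) (complexConj_signVec30 L) (signVec30_ne_zero L)
        (unitVec L) (complexConj_unitVec L) (unitVec_ne_zero L) := rfl

/-- the projection of the `(2,1) × (1)` datum is `π : Mp_ψ(𝕎_𝔸)ᶜᵒⁿᵗ → Sp(𝕎_𝔸)`, `π((g, M_g)) = g`.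
[cite: GelbartRogawski1991, §3.1 p. 454 L21–33] -/
@[simp] theorem cmSplittingDatumU21U1_proj :
    (cmSplittingDatumU21U1 L).proj = adelicMpCont.proj (↥(maximalRealSubfield L)) (Fin 3) _ := rfl

/-- the rational points of the `(2,1) × (1)` datum are `G₁(L⁺) = U(diag(1,1,−1) ⊗ (1))(L⁺)` (print's `G(F)`).
[cite: GelbartRogawski1991, §3.1 p. 454 L43–48] -/
@[simp] theorem cmSplittingDatumU21U1_ratPts :
    (cmSplittingDatumU21U1 L).ratPts =
      (UnitaryGroup.rationalPairToAdelic (↥(maximalRealSubfield L)) L (IsCMField.complexConj L) 3 1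
        (Matrix.diagonal (signVec21 L)) (Matrix.diagonal (unitVec L))).range := rfl

/-- the rational symplectic group of the `(2,1) × (1)` datum is `Sp_{L⁺}(𝕎) = ratSp(Sp₆(L⁺))`, built on the unit
determinant `isUnit_det_adelicGram` (print's `Sp_F(W)`, over which `π` splits uniquely by `i`).
[cite: GelbartRogawski1991, §3.1 p. 454 L34–42] -/
@[simp] theorem cmSplittingDatumU21U1_spRat :
    (cmSplittingDatumU21U1 L).spRat =
      (ratSp (↥(maximalRealSubfield L)) _ (isUnit_det_adelicGram (↥(maximalRealSubfield L)) enum31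
        (isUnit_det_realDiagonal L _ _ (signVec21_ne_zero L))
        (isUnit_det_realDiagonal L _ _ (unitVec_ne_zero L)))).range := rfl

/-- the operators of the datum's section `i = r_F` fix `Θ` (instance of `omega_ratSplit_mem_thetaStabilizer`).
[cite: Weil1964, Chap. III n° 41 Thm 6 p. 193] -/
theorem omega_ratSplit_mem_thetaStabilizer_U21U1 (x : (cmSplittingDatumU21U1 L).spRat) :
    (adelicMpCont.omega (↥(maximalRealSubfield L)) (Fin 3) _).toHomUnits ((cmSplittingDatumU21U1 L).ratSplit x) ∈
      thetaStabilizer (↥(maximalRealSubfield L)) (Fin 3) :=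
  omega_ratSplit_mem_thetaStabilizer _ _ _ _ _ _ _ _ _ _ _ _ _
    (isUnit_det_realDiagonal L _ _ (signVec21_ne_zero L)) (isUnit_det_realDiagonal L _ _ (unitVec_ne_zero L))
    _ _ x

/-- **[GelbartRogawski1991, Prop. 3.1.1] at `(U(2,1), U(1))` ⇒ the binders of the adelic theta kernel of this
pair**: from the HYPOTHESIS `hGR` (the cited proposition at this datum — not asserted here), a compatible splitting
whose pair splitting `U(2,1)(𝔸_{L⁺}) × U(1)(𝔸_{L⁺}) →* Mp_ψ(𝕎_𝔸)ᶜᵒⁿᵗ` is continuous, lies over `ι`, and has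
`Θ`-stable values at rational points (instance of `exists_pairSplitting`).
[cite: GelbartRogawski1991, §3.1 Prop. 3.1.1 p. 455 L1–3; Weil1964, Chap. III n° 41 Thm 6 p. 193] -/
theorem exists_pairSplitting_U21U1 (hGR : (cmSplittingDatumU21U1 L).CompatibleSplitting) :
    ∃ s : UnitaryGroup.adelicPair (↥(maximalRealSubfield L)) L (IsCMField.complexConj L) 3 1
          (Matrix.diagonal (signVec21 L)) (Matrix.diagonal (unitVec L)) →*
        adelicMpCont (↥(maximalRealSubfield L)) (Fin 3)
          (adelicGram (↥(maximalRealSubfield L)) enum31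
            (realDiagonal L (signVec21 L) (complexConj_signVec21 L))
            (realDiagonal L (unitVec L) (complexConj_unitVec L))),
      (cmSplittingDatumU21U1 L).IsCompatible s ∧
      Continuous (pairSplitting (↥(maximalRealSubfield L)) L (IsCMField.complexConj L) 3 1 enum31
        (Matrix.diagonal (signVec21 L)) (Matrix.diagonal (unitVec L)) s) ∧
      (∀ p, adelicMpCont.proj (↥(maximalRealSubfield L)) (Fin 3) _
          (pairSplitting (↥(maximalRealSubfield L)) L (IsCMField.complexConj L) 3 1 enum31
            (Matrix.diagonal (signVec21 L)) (Matrix.diagonal (unitVec L)) s p) =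
        (cmSplittingDatumU21U1 L).toSp
          (UnitaryGroup.adelicInl (↥(maximalRealSubfield L)) L (IsCMField.complexConj L) 3 1
              (Matrix.diagonal (signVec21 L)) (Matrix.diagonal (unitVec L)) p.1 *
            UnitaryGroup.adelicInr (↥(maximalRealSubfield L)) L (IsCMField.complexConj L) 3 1
              (Matrix.diagonal (signVec21 L)) (Matrix.diagonal (unitVec L)) p.2)) ∧
      ∀ γU ∈ (UnitaryGroup.toAdelic (↥(maximalRealSubfield L)) L (IsCMField.complexConj L) 3
          (Matrix.diagonal (signVec21 L))).range,
        ∀ γ ∈ (UnitaryGroup.toAdelic (↥(maximalRealSubfield L)) L (IsCMField.complexConj L) 1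
          (Matrix.diagonal (unitVec L))).range,
        ((adelicMpCont.omega (↥(maximalRealSubfield L)) (Fin 3) _).comp
            (pairSplitting (↥(maximalRealSubfield L)) L (IsCMField.complexConj L) 3 1 enum31
              (Matrix.diagonal (signVec21 L)) (Matrix.diagonal (unitVec L)) s)).toHomUnits (γU, γ) ∈
          thetaStabilizer (↥(maximalRealSubfield L)) (Fin 3) :=
  exists_pairSplitting _ _ _ _ _ _ _ _ _ _ _ _ _
    (isUnit_det_realDiagonal L _ _ (signVec21_ne_zero L)) (isUnit_det_realDiagonal L _ _ (unitVec_ne_zero L))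
    _ _ hGR

end Datum

/-! ## §4. No variables at all: the Gaussian field `ℚ(i) = ℚ(ζ₄)` -/

section Gaussian

open Literature.NumberTheory.ComplexMultiplication.CMTypeCount (GaussianField)

/-- **The splitting datum of `(U(2,1), U(1))` over `ℚ(i)/ℚ`** (`ℚ(i)` = `CMTypeCount.GaussianField`, a CM field by
`CMTypeCount.isCMField_gaussianField`). [cite: GelbartRogawski1991, §3.1 p. 454 L21–48] -/
def gaussianSplittingDatumU21U1 := cmSplittingDatumU21U1 GaussianField

/-- **The splitting datum of `(U(3), U(1))` over `ℚ(i)/ℚ`.** [cite: GelbartRogawski1991, §3.1 p. 454 L21–48] -/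
def gaussianSplittingDatumU3U1 := cmSplittingDatumU3U1 GaussianField

/-- over `ℚ(i)`: `det 𝕋 = −1` for `(U(2,1), U(1))`. [cite: GelbartRogawski1991, §3.1 p. 454 L43–48] -/
theorem algebraMap_det_gram_gaussian_signVec21 :
    algebraMap (↥(maximalRealSubfield GaussianField)) GaussianField
        (gram (↥(maximalRealSubfield GaussianField)) enum31
          (realDiagonal GaussianField (signVec21 GaussianField) (complexConj_signVec21 GaussianField))
          (realDiagonal GaussianField (unitVec GaussianField) (complexConj_unitVec GaussianField))).det = -1 :=
  algebraMap_det_gram_signVec21 GaussianField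

/-- over `ℚ(i)`: the Gram determinant of `(U(2,1), U(1))` is a unit (the tribunal's check, no variables).
[cite: GelbartRogawski1991, §3.1 p. 454 L43–48] -/
theorem isUnit_det_gram_gaussian_signVec21 :
    IsUnit (gram (↥(maximalRealSubfield GaussianField)) enum31
      (realDiagonal GaussianField (signVec21 GaussianField) (complexConj_signVec21 GaussianField))
      (realDiagonal GaussianField (unitVec GaussianField) (complexConj_unitVec GaussianField))).det :=
  isUnit_det_gram_signVec21 GaussianField

end Gaussian

/-! ### Build-lane note (ops-buildfix G11b-3 recipe, LEDGER B13-1, 2026-08-21)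
`lean -o` (the hub build lane, never `lean`/the gate check) runs Lean 4.32's library-suggestion indexers
(`Lean.LibrarySuggestions.SymbolFrequency` / `SineQuaNon`, from their `exportEntriesFn`) over the statement of
every local theorem that is not a denied premise; on this family's statements (very large dependent binder
telescopes through the theta-kernel / dual-pair data) that fold runs for tens of minutes to hours and the build
lane kills the job (incident G11b-3, run/shared/lean/ops/buildfix/G11b-3-DOSSIER.md). `isDeniedPremise` skips
`[implicit_reducible]` constants before any fold, and a reducibility status on a *theorem* is inert (Meta never
unfolds `thmInfo`; the kernel ignores the attribute), so the public theorems of this file are tagged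
`[implicit_reducible]` purely to keep them out of that index. Only other effect: they are not offered by
`+suggestions` premise selectors. No statement or proof is changed; superseded if the operator lands a
deny-list form (`HarnessLib.PremiseIndex`). -/
set_option allowUnsafeReducibility true in
attribute [implicit_reducible]
  signVec21_ne_zero signVec30_ne_zero unitVec_ne_zero complexConj_signVec21 complexConj_signVec30
  complexConj_unitVec isUnit_det_gram_signVec21 isUnit_det_gram_signVec30
  algebraMap_det_gram_signVec21 algebraMap_det_gram_signVec30 cmSplittingDatumU21U1_eq
  cmSplittingDatumU21U1_eq_splittingDatum cmSplittingDatumU3U1_eq cmSplittingDatumU21U1_proj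
  cmSplittingDatumU21U1_ratPts cmSplittingDatumU21U1_spRat omega_ratSplit_mem_thetaStabilizer_U21U1
  exists_pairSplitting_U21U1 algebraMap_det_gram_gaussian_signVec21
  isUnit_det_gram_gaussian_signVec21

end UnitaryDualPair

end Literature.NumberTheory.GelbartRogawski1991

end
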